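import Summits.BirchSwinnertonDyer.BirchSwinnertonDyer.Theorems.KolyvaginRankRigidityAtTwoKolyvaginBoundedDefectAtTwoDepthZero
import Summits.BirchSwinnertonDyer.BirchSwinnertonDyer.Theorems.KolyvaginRankRigidityAtTwoOffHabitatIrredRingClassNoTwoTorsion
import HarnessLib

/-!
# Route `KolyvaginRankRigidityAtTwo`, residual crux R_irr `OffHabitatIrredNonSurjTwoConverse`
# (stmt-BirchSwinnertonDyer-27123, LINE 8): the DEPTH-ZERO RUNG of the seed U1 OFF THE HABITAT —
# bounded defect at `r = 0` on every frame with `y_K` of infinite order, from `E(ℚ)[2] = 0`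
# (helper, PROVED, unconditional; width seat `bsd-line-krr2-p2` g9)

U1 `KolyvaginBoundedDefectAtTwo` (stmt-28083, Kolyvagin's Conjecture A at `2` with margin) carries the
binder `∀ m, ρ̄_{E,2^m} onto`; its depth-zero rung on the habitat
(`KolyvaginAtTwo.boundedDefectAtTwo_depthZero_of_nonTorsion`, p643347: `P(1)` of infinite order ⇒
`2^{M-m-1}·c_M(1) ≠ 0` for all `M > m`, `m` = exact `2`-divisibility depth of `P(1)` in `E(K[1])`)
uses the image only through the `hA` binder `E(K[1])[2^M] = 0`. With the off-habitat supply
`KolyvaginRankRigidity.isAdmissible_pointsSubgroup_two_offHabitat` (landed this generation: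
`E(ℚ)[2] = 0` alone, incl. the cyclic-cubic case by Cox's Lemma 9.3) the same rung holds on the frame
of R_irr: this is the `r = 0` rung of U1-fin, the seed of any ∞-form re-lining of LINE 8 — the
torsion-`y_K` frames remain Kolyvagin's conjecture at `2`, exactly as on the habitat.

* `boundedDefectAtTwo_depthZero_of_nonTorsion_offHabitat` — the habitat statement with
  `(∀ m, ρ̄_{E,2^m} onto)` replaced by `E(ℚ)[2] = 0`;
* `boundedDefectAtTwo_of_nonTorsion_offHabitat` — U1's `∃ r m, …` shape with `r = 0`.

HONEST FRAMING: helper (`--supports` 27123); nothing here closes R_irr or U1; BSD is NOT proved by any of this.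

References: [McCallumLMS1991] §5 (proof of Prop. 5.2, p. 305), §4 (5); [GrossLMS1991] Prop. 4.7 (1),
Lemma 4.3; [Kolyvagin1991MathAnn] §2.
-/

set_option autoImplicit false
-- the Theorems namespace of this sub repeats the summit name by design (D-0017 nested layout)
set_option linter.dupNamespace false

noncomputable section

open scoped Classical

open WeierstrassCurve Field Literature.NumberTheory.EllipticCurves
  Literature.NumberTheory.EllipticCurves.ModularForms

namespace Summit.BirchSwinnertonDyer.BirchSwinnertonDyer.Theorems.KolyvaginAtTwo

/-- **U1 at depth `r = 0` OFF THE HABITAT, per level**: for `W/ℚ` globally minimal non-CM with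
`E(ℚ)[2] = 0` (any `2`-adic image), `K` imaginary quadratic Heegner with `d_K` odd, and a frame whose
`P(1)` has infinite order, with `m` the exact `2`-divisibility depth of `P(1)` in `E(K[1])`: for every
`M > m`, `2^(M−m−1)·c_M(1) ≠ 0`, `n = 1` has depth `0` and `M ≤ M(1) = ∞`.
[cite: McCallumLMS1991, §5, proof of Prop. 5.2 (p. 305)] [cite: GrossLMS1991, Prop. 4.7 (1), Lemma 4.3] -/
theorem boundedDefectAtTwo_depthZero_of_nonTorsion_offHabitat :
    ∀ (W : WeierstrassCurve ℚ) [W.IsElliptic] [W.IsGloballyMinimal], ¬ W.HasCM →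
      (Literature.NumberTheory.EllipticCurves.Rank1Residual.GoodOrd W 2 ∨
        Literature.NumberTheory.EllipticCurves.Rank1Residual.Mult W 2) →
      AddSubgroup.torsionBy W.toAffine.Point (2 : ℤ) = ⊥ →
      ∀ (K : Type) [Field K] [NumberField K], Literature.NumberTheory.EllipticCurves.IsImaginaryQuadratic K →
      ∀ [NeZero (W.conductorNorm ℤ)],
      Literature.NumberTheory.EllipticCurves.SatisfiesHeegnerHypothesis (W.conductorNorm ℤ) K →
      Odd (NumberField.discr K) → NumberField.discr K ≠ -3 →
      AddSubgroup.torsionBy (W.baseChange K).toAffine.Point (2 : ℤ) = ⊥ →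
      Literature.NumberTheory.EllipticCurves.SatisfiesHeegnerHypothesis 2 K →
      ∀ (Dt : Literature.NumberTheory.EllipticCurves.ModularForms.ModularParametrizationData W (W.conductorNorm ℤ))
        (β : ℤ) (ι : K →+* ℂ), (4 * (W.conductorNorm ℤ : ℤ)) ∣ β ^ 2 - NumberField.discr K →
      (∃ d₁ : Literature.NumberTheory.EllipticCurves.KolyvaginHeegnerData Dt β ι 1, ¬ IsOfFinAddOrder d₁.derivedPoint) →
      ∃ m : ℕ, ∀ M : ℕ, m < M →
        ∃ (n : ℕ) (d : Literature.NumberTheory.EllipticCurves.KolyvaginHeegnerData Dt β ι n),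
          Literature.NumberTheory.EllipticCurves.KolyvaginDescent.KolSupp
            (Literature.NumberTheory.EllipticCurves.Zhang2014.IsKolyvaginPrime (W.conductorNorm ℤ) W K 2) n ∧
          n.primeFactors.card = 0 ∧
          ((M : ℕ) : ℕ∞) ≤ Literature.NumberTheory.EllipticCurves.Zhang2014.levelIndex W 2 n ∧
          (2 ^ (M - m - 1) : ℤ) • d.kolyvaginClass Nat.prime_two M ≠ 0 := by
  intro W _ _ _ _ htorQ K _ _ hK _ hHN hodd _ _ _ Dt β ι _ hex
  obtain ⟨d₁, hnt⟩ := hex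
  have hodd' : ¬ (2 : ℤ) ∣ NumberField.discr K := fun h2 ↦
    (Int.not_even_iff_odd.mpr hodd) (even_iff_two_dvd.mpr h2)
  -- `E(K[1])` is finitely generated (Mordell–Weil over the number field `K[1]`)
  haveI := (finiteDimensional_and_isGalois_ringClassField hK ι one_ne_zero).1
  haveI : NumberField (ringClassField K ι 1) := NumberField.of_module_finite K _
  haveI : (W.baseChange (ringClassField K ι 1)).IsElliptic := by rw [baseChange]; infer_instance
  haveI : Module.Finite ℤ (W.baseChange (ringClassField K ι 1)).toAffine.Point := by
    convert (W.baseChange (ringClassField K ι 1)).module_finite_point_holds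
  -- the exact `2`-divisibility depth `m` of `P(1)`
  obtain ⟨m, hdvd, hndvd⟩ := exists_exactTwoDepth
    (A := (W.baseChange (ringClassField K ι 1)).toAffine.Point) (y := d₁.derivedPoint) (by convert hnt)
  refine ⟨m, fun M hM ↦ ⟨1, d₁, KolyvaginDescent.kolSupp_one _, by simp, by simp [Zhang2014.levelIndex_one], ?_⟩⟩
  -- the order of `c_M(1)` is `2^(M-m)` (McCallum p. 305), from the OFF-HABITAT standing inputs
  have hA := KolyvaginRankRigidity.isAdmissible_pointsSubgroup_two_offHabitat d₁ htorQ hK hodd' hHN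
    one_ne_zero (by decide) (Nat.coprime_one_right _) M
  have hP := toGeomPoints_derivedPoint_one_mem_invPoints hK hHN d₁ ((2 ^ M : ℕ) : ℤ)
  have hord := Summit.BirchSwinnertonDyer.Rank1Residual.JET.addOrderOf_kolyvaginClass_of_exactDepth d₁
    Nat.prime_two hM.le hA hP (by convert hdvd) (by convert hndvd)
  -- so `2^(M-m-1) • c_M(1) ≠ 0`
  intro h0
  have h0' : (2 ^ (M - m - 1)) • d₁.kolyvaginClass Nat.prime_two M = 0 := by
    rw [← natCast_zsmul]; push_cast; exact h0
  have hdv : 2 ^ (M - m) ∣ 2 ^ (M - m - 1) := by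
    rw [← hord]; exact addOrderOf_dvd_of_nsmul_eq_zero h0'
  have hle := (Nat.pow_dvd_pow_iff_le_right one_lt_two).mp hdv
  omega

/-- **The depth-zero rung in U1's shape, OFF THE HABITAT** (`∃ r m, …` with `r = 0`; frame binder
`E(ℚ)[2] = 0` in place of the surjective `2`-adic tower). [cite: McCallumLMS1991, §5, proof of Prop. 5.2 (p. 305)]
[cite: Kolyvagin1991MathAnn, §2] -/
theorem boundedDefectAtTwo_of_nonTorsion_offHabitat :
    ∀ (W : WeierstrassCurve ℚ) [W.IsElliptic] [W.IsGloballyMinimal], ¬ W.HasCM →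
      (Literature.NumberTheory.EllipticCurves.Rank1Residual.GoodOrd W 2 ∨
        Literature.NumberTheory.EllipticCurves.Rank1Residual.Mult W 2) →
      AddSubgroup.torsionBy W.toAffine.Point (2 : ℤ) = ⊥ →
      ∀ (K : Type) [Field K] [NumberField K], Literature.NumberTheory.EllipticCurves.IsImaginaryQuadratic K →
      ∀ [NeZero (W.conductorNorm ℤ)],
      Literature.NumberTheory.EllipticCurves.SatisfiesHeegnerHypothesis (W.conductorNorm ℤ) K →
      Odd (NumberField.discr K) → NumberField.discr K ≠ -3 →
      AddSubgroup.torsionBy (W.baseChange K).toAffine.Point (2 : ℤ) = ⊥ →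
      Literature.NumberTheory.EllipticCurves.SatisfiesHeegnerHypothesis 2 K →
      ∀ (Dt : Literature.NumberTheory.EllipticCurves.ModularForms.ModularParametrizationData W (W.conductorNorm ℤ))
        (β : ℤ) (ι : K →+* ℂ), (4 * (W.conductorNorm ℤ : ℤ)) ∣ β ^ 2 - NumberField.discr K →
      (∃ d₁ : Literature.NumberTheory.EllipticCurves.KolyvaginHeegnerData Dt β ι 1, ¬ IsOfFinAddOrder d₁.derivedPoint) →
      ∃ r m : ℕ, ∀ M : ℕ, m < M →
        ∃ (n : ℕ) (d : Literature.NumberTheory.EllipticCurves.KolyvaginHeegnerData Dt β ι n),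
          Literature.NumberTheory.EllipticCurves.KolyvaginDescent.KolSupp
            (Literature.NumberTheory.EllipticCurves.Zhang2014.IsKolyvaginPrime (W.conductorNorm ℤ) W K 2) n ∧
          n.primeFactors.card = r ∧
          ((M : ℕ) : ℕ∞) ≤ Literature.NumberTheory.EllipticCurves.Zhang2014.levelIndex W 2 n ∧
          (2 ^ (M - m - 1) : ℤ) • d.kolyvaginClass Nat.prime_two M ≠ 0 :=
  fun W _ _ hCM hred htorQ K _ _ hK _ hHN hodd hne3 htor hH2 Dt β ι hβ hex ↦
    ⟨0, boundedDefectAtTwo_depthZero_of_nonTorsion_offHabitat W hCM hred htorQ K hK hHN hodd hne3 htor hH2 Dt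
      β ι hβ hex⟩

end Summit.BirchSwinnertonDyer.BirchSwinnertonDyer.Theorems.KolyvaginAtTwo

end
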